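/-
Copyright (c) 2026 the pub-hodgecm-mathlib formalisation cell (harness21).  Prover seat hodgecm-mathlib-K2Liu-p13 (g2), Track B «K2-LIT»,
#184♮ = hLiu418 = `stmt-HodgeConjecture-24832`; Road I v3 organ U1-CT-ind STAGE 2 (Q2), file F9 (continuity of the post-`u₊` inner section: the `hFc` input of ★∕📤 F8).
-/
import Summits.HodgeConjecture.HodgeConjecture.Theorems.K2LiuKlingenRestrictedSectionE1Law      -- ★ F7: `continuous_restrictedSection`-style matrix continuity, `klingenLevi_one_inv`, `coe_jAdelic_two_symm`
import Mathlib.MeasureTheory.Integral.DominatedConvergence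
import HarnessLib

/-!
# Crux `HLiu418`, Road I v3, organ U1 stage 2 (Q2), file F9: CONTINUITY OF THE POST-`u₊` INNER SECTION `x ↦ ∫ f(Ψ(ξ)·Ψ(n_Q(y,0,t))·x) d(μ_Y × μ_T)` FROM A MAJORANT —
# dominated convergence (Mathlib `continuous_of_dominated`; `H(𝔸)` is metrizable), and the composite `y ↦ F′_h(y)` on `U(J₂)(𝔸)` (★∕📤 F8's `hFc`)

Cell `hodgecm-mathlib`, crux item hLiu418 = `stmt-HodgeConjecture-24832`; squad K2 ∕ K2Liu; LEAD F0P6-plan (g14), co-dealer K2E5-plan (g7); prover K2Liu-p13 (g2).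
THEOREMS ONLY (no `def`, no instance, no notation, no named-fact hypothesis, no `sorry`); lane `--supports stmt-HodgeConjecture-24832 --as helper` (count-neutral).
* **`continuous_innerSection_of_bound`** — `f` continuous, a majorant `‖f(Ψ(ξ)·Ψ(n_Q(q))·x)‖ ≤ bound q` for all `x` with `bound` integrable for `μ_Y × μ_T` (BY VALUE: the (H)-type
  absolute-convergence datum of the intertwining integral, uniform in `x`; a locally uniform majorant gives continuity on compacts the same way) ⇒ `x ↦ F(x)` continuous on `H(𝔸)`.
* `continuous_transport_klingenLevi_two` — `y ↦ Ψ(jAdelic₄ m_Q^𝔸(1, (jAdelic 2)⁻¹ y)) ∈ H(𝔸)` is continuous on `U(J₂)(𝔸)` (matrix level, clause (T1)).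
* **`continuous_innerSection_comp_klingenLevi`** — hence `y ↦ F′_h(y) = F(Ψ(jAdelic₄ m_Q^𝔸(1, j₂⁻¹y))·h)` is continuous: the `hFc` of ★∕📤 F8 `summable_innerSection_of_continuous`.
[MoeglinWaldspurger1995, II.1.5, II.1.7], [Folland1995, §2.3 (dominated convergence)].
HONEST LABEL.  Count-neutral helper: `HC_CM` is proved only modulo the 7 printed citations (2 remaining named inputs: hLiu418 = `stmt-HodgeConjecture-24832`,
h413 = `stmt-HodgeConjecture-24833`) until rung 0 closes.
-/

set_option autoImplicit false
set_option linter.dupNamespace false -- the mandated namespace repeats `HodgeConjecture.HodgeConjecture`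

noncomputable section

open scoped Matrix ENNReal NNReal
open NumberField IsDedekindDomain MeasureTheory MeasureTheory.Measure

namespace Summit.HodgeConjecture.HodgeConjecture.Cruxes.HLiu418.K2LiuKlingenInnerSectionContinuous

open Literature.NumberTheory.Automorphic Literature.NumberTheory.Automorphic.UnitaryGroup
open Literature.NumberTheory.GelbartRogawski1991 Literature.NumberTheory.GelbartRogawski1991.GRConstruction
open Literature.NumberTheory.K2Lit.SiegelDoubled
open Summit.HodgeConjecture.HodgeConjecture.Cruxes.HLiu418.K2LiuDoubledUTwoTwoBorelFrame
open Summit.HodgeConjecture.HodgeConjecture.Cruxes.HLiu418.K2LiuKlingenParabolicDefs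
open Summit.HodgeConjecture.HodgeConjecture.Cruxes.HLiu418.K2LiuKlingenUnipotentAdelicDefs
open Summit.HodgeConjecture.HodgeConjecture.Cruxes.HLiu418.K2LiuKlingenUnipotentAdelicChart (continuous_transport_nKlingen continuous_nKlingenM)
open Summit.HodgeConjecture.HodgeConjecture.Cruxes.HLiu418.K2LiuKlingenRestrictedSectionE1Law (coe_jAdelic_two_symm klingenLevi_one_inv)
open Summit.HodgeConjecture.HodgeConjecture.Cruxes.HLiu418.K2LiuSiegelDoubledLeviMatrix (conjAdele_conjAdele')
open UnitaryDualPair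

variable {L : Type} [Field L] [NumberField L] [IsCMField L]
variable {N M : ℕ} {e : Fin N × Fin M ≃ Fin 2}
  {dV : Fin N → L} {hdV : ∀ i, IsCMField.complexConj L (dV i) = dV i}
  {dW : Fin M → L} {hdW : ∀ i, IsCMField.complexConj L (dW i) = dW i}

section Transport

variable {SA : GL (Fin (2 + 2)) (AdeleRing (𝓞 L) L)}
  {Ψ : (quasiSplit (Fp L) L (IsCMField.complexConj L) (2 + 2)).Adelic ≃ₜ* HA L e dV hdV dW hdW}
  (hΨ : ∀ g : (quasiSplit (Fp L) L (IsCMField.complexConj L) (2 + 2)).Adelic,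
      (((Ψ g : HA L e dV hdV dW hdW) : GL (Fin (2 + 2)) (AdeleRing (𝓞 L) L)) : Matrix (Fin (2 + 2)) (Fin (2 + 2)) (AdeleRing (𝓞 L) L)) =
        (SA : Matrix (Fin (2 + 2)) (Fin (2 + 2)) (AdeleRing (𝓞 L) L)) *
          ((adelicVal (Fp L) L (IsCMField.complexConj L) (2 + 2) _ g : GL (Fin (2 + 2)) (AdeleRing (𝓞 L) L)) :
            Matrix (Fin (2 + 2)) (Fin (2 + 2)) (AdeleRing (𝓞 L) L)) *
          ((SA⁻¹ : GL (Fin (2 + 2)) (AdeleRing (𝓞 L) L)) : Matrix (Fin (2 + 2)) (Fin (2 + 2)) (AdeleRing (𝓞 L) L)))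

include hΨ in
/-- **CONTINUITY OF THE POST-`u₊` INNER SECTION FROM A MAJORANT** (dominated convergence on the metrizable `H(𝔸)`): `f` continuous, `‖f(Ψ(ξ)·Ψ(n_Q(q.1,0,q.2))·x)‖ ≤ bound q`
for all `x`, `bound` integrable ⇒ `x ↦ ∫ f(Ψ(ξ)·Ψ(n_Q(q.1,0,q.2))·x) d(μ_Y × μ_T)` is continuous. [cite: Folland1995, §2.3] [cite: MoeglinWaldspurger1995, II.1.7] -/
theorem continuous_innerSection_of_bound [MeasurableSpace (AdeleRing (𝓞 L) L)] [BorelSpace (AdeleRing (𝓞 L) L)] [SecondCountableTopology (AdeleRing (𝓞 L) L)]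
    (Y : AddSubgroup (AdeleRing (𝓞 L) L)) (hY : ∀ y, y ∈ Y ↔ conjAdele (Fp L) L (IsCMField.complexConj L) y = -y) (μ : Measure (↥Y × AdeleRing (𝓞 L) L))
    {f : HA L e dV hdV dW hdW → ℂ} (hfc : Continuous f) {bound : ↥Y × AdeleRing (𝓞 L) L → ℝ} (hbound_int : Integrable bound μ)
    (hbound : ∀ (x : HA L e dV hdV dW hdW) (q : ↥Y × AdeleRing (𝓞 L) L), ‖f (Ψ (jAdelic L 4 (weylXi (AdeleRing (𝓞 L) L) (conjAdele (Fp L) L (IsCMField.complexConj L)))) * Ψ (jAdelic L 4 (nKlingen (AdeleRing (𝓞 L) L) (conjAdele (Fp L) L (IsCMField.complexConj L)) (conjAdele_conjAdele' L) (((q.1 : ↥Y) : AdeleRing (𝓞 L) L)) ((hY _).1 q.1.2) 0 (q.2))) * (x))‖ ≤ bound q) :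
    Continuous fun x : HA L e dV hdV dW hdW => ∫ q : ↥Y × AdeleRing (𝓞 L) L, f (Ψ (jAdelic L 4 (weylXi (AdeleRing (𝓞 L) L) (conjAdele (Fp L) L (IsCMField.complexConj L)))) * Ψ (jAdelic L 4 (nKlingen (AdeleRing (𝓞 L) L) (conjAdele (Fp L) L (IsCMField.complexConj L)) (conjAdele_conjAdele' L) (((q.1 : ↥Y) : AdeleRing (𝓞 L) L)) ((hY _).1 q.1.2) 0 (q.2))) * (x)) ∂μ := by
  haveI : SecondCountableTopology ↥Y := TopologicalSpace.Subtype.secondCountableTopology (Y : Set (AdeleRing (𝓞 L) L))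
  -- joint continuity of the integrand in `(q, x)`
  have hN : Continuous fun q : ↥Y × AdeleRing (𝓞 L) L => (Ψ (jAdelic L 4 (nKlingen (AdeleRing (𝓞 L) L) (conjAdele (Fp L) L (IsCMField.complexConj L)) (conjAdele_conjAdele' L) (((q.1 : ↥Y) : AdeleRing (𝓞 L) L)) ((hY _).1 q.1.2) 0 (q.2))) : HA L e dV hdV dW hdW) :=
    continuous_transport_nKlingen hΨ (fun q : ↥Y × AdeleRing (𝓞 L) L => (hY _).1 q.1.2) (continuous_subtype_val.comp continuous_fst) continuous_const continuous_snd
  refine continuous_of_dominated (fun x => ?_) (fun x => Filter.Eventually.of_forall (hbound x)) hbound_int (Filter.Eventually.of_forall fun q => ?_)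
  · exact (hfc.comp ((continuous_const.mul hN).mul continuous_const)).aestronglyMeasurable
  · exact hfc.comp ((continuous_const.mul continuous_const).mul continuous_id)

include hΨ in
/-- **`y ↦ Ψ(jAdelic₄ m_Q^𝔸(1, (jAdelic 2)⁻¹ y)) ∈ H(𝔸)` is continuous on `U(J₂)(𝔸_{L⁺})`** (matrix level through clause (T1): both the letter and its inverse `m_Q(1, y⁻¹)` have matrices
`SA·m·SA⁻¹` polynomial in the entries of `y`). [cite: MoeglinWaldspurger1995, II.1.5] -/
theorem continuous_transport_klingenLevi_two :
    Continuous fun y : (quasiSplit (Fp L) L (IsCMField.complexConj L) 2).Adelic => (Ψ (jAdelic L 4 (klingenLevi (AdeleRing (𝓞 L) L) (conjAdele (Fp L) L (IsCMField.complexConj L)) (conjAdele_conjAdele' L) 1 ((jAdelic L 2).symm y))) : HA L e dV hdV dW hdW) := by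
  have hval : Continuous fun y' : (quasiSplit (Fp L) L (IsCMField.complexConj L) 2).Adelic => klingenLeviM (AdeleRing (𝓞 L) L) (conjAdele (Fp L) L (IsCMField.complexConj L)) 1 ((jAdelic L 2).symm y') := by
    refine continuous_matrix fun i j => ?_
    have hB : Continuous fun y' : (quasiSplit (Fp L) L (IsCMField.complexConj L) 2).Adelic => (((((jAdelic L 2).symm y' : unitaryGroupOfForm (conjAdele (Fp L) L (IsCMField.complexConj L)) ((StdForm.antidiagonal 2).over (AdeleRing (𝓞 L) L))) :
        GL (Fin 2) (AdeleRing (𝓞 L) L)) : Matrix (Fin 2) (Fin 2) (AdeleRing (𝓞 L) L))) := by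
      simp_rw [coe_jAdelic_two_symm]
      exact Units.continuous_val.comp continuous_subtype_val
    fin_cases i <;> fin_cases j <;> simp [klingenLeviM] <;> first | exact continuous_const | exact (hB.matrix_elem _ _)
  refine continuous_induced_rng.2 (Units.continuous_iff.2 ⟨?_, ?_⟩)
  · have hm : ∀ y : (quasiSplit (Fp L) L (IsCMField.complexConj L) 2).Adelic, (((Ψ (jAdelic L 4 (klingenLevi (AdeleRing (𝓞 L) L) (conjAdele (Fp L) L (IsCMField.complexConj L)) (conjAdele_conjAdele' L) 1 ((jAdelic L 2).symm y))) : HA L e dV hdV dW hdW) : GL (Fin (2 + 2)) (AdeleRing (𝓞 L) L)) : Matrix (Fin (2 + 2)) (Fin (2 + 2)) (AdeleRing (𝓞 L) L)) =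
        (SA : Matrix (Fin (2 + 2)) (Fin (2 + 2)) (AdeleRing (𝓞 L) L)) * klingenLeviM (AdeleRing (𝓞 L) L) (conjAdele (Fp L) L (IsCMField.complexConj L)) 1 ((jAdelic L 2).symm y) *
          ((SA⁻¹ : GL (Fin (2 + 2)) (AdeleRing (𝓞 L) L)) : Matrix (Fin (2 + 2)) (Fin (2 + 2)) (AdeleRing (𝓞 L) L)) := fun y => by
      rw [hΨ, coe_adelicVal_jAdelic, coe_klingenLevi]
    exact ((continuous_const.mul hval).mul continuous_const).congr fun y => (hm y).symm
  · have hm : ∀ y : (quasiSplit (Fp L) L (IsCMField.complexConj L) 2).Adelic, (((((Ψ (jAdelic L 4 (klingenLevi (AdeleRing (𝓞 L) L) (conjAdele (Fp L) L (IsCMField.complexConj L)) (conjAdele_conjAdele' L) 1 ((jAdelic L 2).symm y))) : HA L e dV hdV dW hdW) : GL (Fin (2 + 2)) (AdeleRing (𝓞 L) L)))⁻¹ : GL (Fin (2 + 2)) (AdeleRing (𝓞 L) L)) :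
          Matrix (Fin (2 + 2)) (Fin (2 + 2)) (AdeleRing (𝓞 L) L)) =
        (SA : Matrix (Fin (2 + 2)) (Fin (2 + 2)) (AdeleRing (𝓞 L) L)) * klingenLeviM (AdeleRing (𝓞 L) L) (conjAdele (Fp L) L (IsCMField.complexConj L)) 1 ((jAdelic L 2).symm y⁻¹) *
          ((SA⁻¹ : GL (Fin (2 + 2)) (AdeleRing (𝓞 L) L)) : Matrix (Fin (2 + 2)) (Fin (2 + 2)) (AdeleRing (𝓞 L) L)) := fun y => by
      rw [← Subgroup.coe_inv, ← map_inv Ψ, ← map_inv (jAdelic L 4), ← klingenLevi_one_inv (conjAdele_conjAdele' L), ← map_inv (jAdelic L 2).symm, hΨ,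
        coe_adelicVal_jAdelic, coe_klingenLevi]
    exact ((continuous_const.mul (hval.comp continuous_inv)).mul continuous_const).congr fun y => (hm y).symm

include hΨ in
/-- **`y ↦ F′_h(y)` IS CONTINUOUS** (the `hFc` of ★∕📤 F8 `summable_innerSection_of_continuous`), from the majorant of `continuous_innerSection_of_bound`.
[cite: MoeglinWaldspurger1995, II.1.5, II.1.7] -/
theorem continuous_innerSection_comp_klingenLevi [MeasurableSpace (AdeleRing (𝓞 L) L)] [BorelSpace (AdeleRing (𝓞 L) L)] [SecondCountableTopology (AdeleRing (𝓞 L) L)]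
    (Y : AddSubgroup (AdeleRing (𝓞 L) L)) (hY : ∀ y, y ∈ Y ↔ conjAdele (Fp L) L (IsCMField.complexConj L) y = -y) (μ : Measure (↥Y × AdeleRing (𝓞 L) L))
    {f : HA L e dV hdV dW hdW → ℂ} (hfc : Continuous f) {bound : ↥Y × AdeleRing (𝓞 L) L → ℝ} (hbound_int : Integrable bound μ)
    (hbound : ∀ (x : HA L e dV hdV dW hdW) (q : ↥Y × AdeleRing (𝓞 L) L), ‖f (Ψ (jAdelic L 4 (weylXi (AdeleRing (𝓞 L) L) (conjAdele (Fp L) L (IsCMField.complexConj L)))) * Ψ (jAdelic L 4 (nKlingen (AdeleRing (𝓞 L) L) (conjAdele (Fp L) L (IsCMField.complexConj L)) (conjAdele_conjAdele' L) (((q.1 : ↥Y) : AdeleRing (𝓞 L) L)) ((hY _).1 q.1.2) 0 (q.2))) * (x))‖ ≤ bound q) (h : HA L e dV hdV dW hdW) :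
    Continuous fun y : (quasiSplit (Fp L) L (IsCMField.complexConj L) 2).Adelic => ∫ q : ↥Y × AdeleRing (𝓞 L) L, f (Ψ (jAdelic L 4 (weylXi (AdeleRing (𝓞 L) L) (conjAdele (Fp L) L (IsCMField.complexConj L)))) * Ψ (jAdelic L 4 (nKlingen (AdeleRing (𝓞 L) L) (conjAdele (Fp L) L (IsCMField.complexConj L)) (conjAdele_conjAdele' L) (((q.1 : ↥Y) : AdeleRing (𝓞 L) L)) ((hY _).1 q.1.2) 0 (q.2))) * (Ψ (jAdelic L 4 (klingenLevi (AdeleRing (𝓞 L) L) (conjAdele (Fp L) L (IsCMField.complexConj L)) (conjAdele_conjAdele' L) 1 ((jAdelic L 2).symm y))) * h)) ∂μ :=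
  (continuous_innerSection_of_bound hΨ Y hY μ hfc hbound_int hbound).comp ((continuous_transport_klingenLevi_two hΨ).mul continuous_const)

end Transport

end Summit.HodgeConjecture.HodgeConjecture.Cruxes.HLiu418.K2LiuKlingenInnerSectionContinuous

end
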